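import Mathlib
import Summits.QuantumFields.YangMills.Theses.LangevinControlUV

/-!
# Sketch — crux-ideate stmt-QuantumFields-9366 (LatticeGapInUVUnits), ideator 3, round 1

First lemmas of the two idea cards (signatures only; `sorry` bodies), checked to elaborate.
-/

open scoped BigOperators InnerProductSpace
open MeasureTheory

namespace Summit.QuantumFields.YangMills.Cruxes.LatticeGapInUVUnits.Ideator3

/-! ## Card `heatbath-knabe-threshold` — first lemma

Abstract Knabe–Lemm local-gap threshold for a translation-covariant family of orthogonal
projections on a real Hilbert space indexed by the coarse torus `(ℤ/M)⁴`, commuting beyond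
ℓ^∞-distance 1 (the commutation pattern of overlapping-block heat-bath projections `1 − E_B` of a
nearest-neighbour Markov field).  Hypothesis: every translate of the `n⁴`-cube local Hamiltonian
`h_l = ∑_{c ∈ [0,n)⁴} Q (l + c)` satisfies `h_l² ≥ γ h_l` (local gap `γ`, as an operator on the
GLOBAL space = worst-exterior gap).  Conclusion: `H² ≥ (γ − 432/n) H` for `H = ∑ₓ Q x`
(threshold `432/n → 0`; derivation in NOTES.md §Knabe-count, following Knabe 1988 / Lemm 2019 §4). -/
theorem knabe_linfty_threshold
    {E : Type*} [NormedAddCommGroup E] [InnerProductSpace ℝ E] [CompleteSpace E]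
    (M n : ℕ) [NeZero M] (hn : 1 ≤ n) (hM : 2 * n + 1 ≤ M)
    (Q : (Fin 4 → ZMod M) → E →L[ℝ] E)
    (hproj : ∀ x, IsSelfAdjoint (Q x) ∧ Q x * Q x = Q x)
    (hcomm : ∀ x y : Fin 4 → ZMod M,
      (∃ k, 2 ≤ ((x k - y k).valMinAbs).natAbs) → Q x * Q y = Q y * Q x)
    (γ : ℝ)
    (hloc : ∀ (l : Fin 4 → ZMod M) (v : E),
      γ * ⟪v, (∑ c : Fin 4 → Fin n, Q (l + fun k => ((c k : ℕ) : ZMod M))) v⟫_ℝ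
        ≤ ‖(∑ c : Fin 4 → Fin n, Q (l + fun k => ((c k : ℕ) : ZMod M))) v‖ ^ 2) :
    ∀ v : E, (γ - 432 / n) * ⟪v, (∑ x, Q x) v⟫_ℝ ≤ ‖(∑ x, Q x) v‖ ^ 2 := by
  sorry

/-! ## Card `femto-sigma-algebra-split` — first lemma

Law of total covariance with respect to a sub-σ-algebra `m` (to be the σ-algebra generated by the
femto-scale block averages of the gauge field): the connected correlation splits EXACTLY into the
covariance of the conditional expectations (infrared effective theory) plus the mean conditional
covariance (ultraviolet fluctuation part), with no cross terms. -/
theorem total_covariance_split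
    {Ω : Type*} {m m₀ : MeasurableSpace Ω} (hm : m ≤ m₀) (μ : Measure[m₀] Ω)
    [IsProbabilityMeasure μ] (f g : Ω → ℝ)
    (hf : MemLp f 2 μ) (hg : MemLp g 2 μ) :
    (∫ ω, f ω * g ω ∂μ) - (∫ ω, f ω ∂μ) * (∫ ω, g ω ∂μ)
      = ((∫ ω, (μ[f|m]) ω * (μ[g|m]) ω ∂μ) - (∫ ω, f ω ∂μ) * (∫ ω, g ω ∂μ))
        + ∫ ω, (f ω - (μ[f|m]) ω) * (g ω - (μ[g|m]) ω) ∂μ := by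
  sorry

/-- The crux-level reduction the split is used for (shape only): if along the time axis both the
IR part and the UV part of the connected correlation of two gauge-invariant observables are bounded
by `C e^{-c a n}`, so is `latticeConnectedCorr` with constant `2C`.  Stated over the route's
`latticeConnectedCorr`; the two hypotheses are what cards K1 (renormalised-trajectory gap) and
K2 (constrained-fluctuation locality) must deliver. -/
theorem latticeConnectedCorr_le_of_split
    {G : Type} [Group G] [TopologicalSpace G] [IsTopologicalGroup G] [CompactSpace G]
    [MeasurableSpace G] [BorelSpace G] {N : ℕ}
    (ρ : G →* Matrix (Fin N) (Fin N) ℂ) (β a c C : ℝ) (S : ℕ) [NeZero S]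
    (A B : Literature.MathematicalPhysics.QuantumLattice.LGConfig 4 G → ℝ) (n : ℕ)
    (IR UV : ℝ)
    (hsplit : Literature.MathematicalPhysics.QuantumFieldTheory.latticeConnectedCorr ρ β (2 * S + 1) A B n
        = IR + UV)
    (hIR : |IR| ≤ C * Real.exp (-(c * a * n))) (hUV : |UV| ≤ C * Real.exp (-(c * a * n))) :
    |Literature.MathematicalPhysics.QuantumFieldTheory.latticeConnectedCorr ρ β (2 * S + 1) A B n|
      ≤ 2 * C * Real.exp (-(c * a * n)) := by
  rw [hsplit]
  calc |IR + UV| ≤ |IR| + |UV| := abs_add_le IR UV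
    _ ≤ C * Real.exp (-(c * a * n)) + C * Real.exp (-(c * a * n)) := add_le_add hIR hUV
    _ = 2 * C * Real.exp (-(c * a * n)) := by ring

end Summit.QuantumFields.YangMills.Cruxes.LatticeGapInUVUnits.Ideator3
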